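import Literature.AlgebraicGeometry.Surfaces.K3SurfaceProofs
import Mathlib.LinearAlgebra.FiniteDimensional.Lemmas
import Mathlib.Analysis.Complex.Basic

/-!
# Route AnchorTransport — `AnchorExistence` (stmt-HodgeConjecture-1077), line `Sketch`, CM floor:
# the K3 lattice has signature `(3, 19)` — the real computation

The positivity input of the polarization of the transcendental Hodge structure `T(S)_ℚ` of a
projective K3 surface, in the marking picture (`Λ_ℂ = ℂ²²`, `k3Form`): the K3 lattice
`Λ = E₈(−1)^{⊕2} ⊕ U^{⊕3}` has signature `(3, 19)` (Huybrechts, *Lectures on K3 Surfaces*, Ch. 1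
Prop. 3.5), the period `x` (`(x.x) = 0`, `(x.x̄) > 0`) spans with its conjugate a positive real
plane, and an ample class `u` (`(u.x) = 0`, `(u.u) > 0`) a third positive direction; hence the
form is NEGATIVE definite on the real vectors orthogonal to `x, x̄, u` — in particular
`(v.v̄) < 0` for every non-zero `v ∈ Λ_ℂ` orthogonal to `x`, `x̄` and `u` (the transcendental
`(1,1)`-classes), which is the second Hodge–Riemann relation `-(v.v̄) > 0` on `T^{1,1}`
(Huybrechts Ch. 3 §1.2, Def. 1.6 and Lemma 3.1: "`T(X)` is a polarizable irreducible Hodge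
structure"). THIS FILE: the real statement — the real K3 form `k3FormR` on `ℝ²²`, positivity of
`E₈` over `ℝ` (Serre's sum of squares), the block expansion of `Λ`, the explicit negative definite
`19`-space `E₈(−1)^{⊕2}_ℝ ⊕ ⟨eₖ − fₖ⟩` (`ker negMap`) and Sylvester by hand: the form is negative
definite on the orthogonal complement of three pairwise orthogonal positive vectors, since a
positive semi-definite real `4`-space would meet the negative `19`-space trivially and
`4 + 19 > 22` (`k3FormR_self_neg_of_orthogonal`). The passage from `Λ_ℂ` is in `…CMFloorSignature`.

## References

* [Huybrechts2016K3] D. Huybrechts, Lectures on K3 Surfaces, CUP 2016, Ch. 1 Prop. 3.5 (signature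
  `(3,19)`), Ch. 3 §1.2 Def. 1.6 and Lemma 3.3.1, Ch. 6 §1.1 (the period domain).
* [Serre1973] J.-P. Serre, A Course in Arithmetic, Springer 1973, Ch. V §1.4.3 (`E₈` is positive
  definite).
-/

noncomputable section

set_option linter.dupNamespace false

open Module
open Literature.AlgebraicGeometry.Surfaces

namespace Summit.HodgeConjecture.HodgeConjecture.Theorems.AnchorExistenceCMFloor

/-! ### The real K3 form -/

/-- The real K3 form on `Λ_ℝ = ℝ²²`, `(a.b) = Σᵢⱼ aᵢ Λᵢⱼ bⱼ`, as a Mathlib bilinear form.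
[cite: Huybrechts2016K3, Ch. 1 Prop. 3.5] -/
def k3FormR : LinearMap.BilinForm ℝ (K3Index → ℝ) :=
  Matrix.toBilin' (k3Gram.map (Int.cast : ℤ → ℝ))

/-- The defining double sum of the real K3 form. [folklore] -/
theorem k3FormR_apply (a b : K3Index → ℝ) :
    k3FormR a b = ∑ i, ∑ j, a i * (k3Gram i j : ℝ) * b j := by
  rw [k3FormR, Matrix.toBilin'_apply]
  rfl

/-- The real K3 form is symmetric. [folklore] -/
theorem k3FormR_comm (a b : K3Index → ℝ) : k3FormR a b = k3FormR b a := by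
  rw [k3FormR_apply, k3FormR_apply, Finset.sum_comm]
  refine Finset.sum_congr rfl fun i _ => Finset.sum_congr rfl fun j _ => ?_
  rw [k3Gram_apply_comm j i]
  ring

/-- The complex K3 form on real vectors is the real K3 form. [folklore] -/
theorem k3Form_realCast (a b : K3Index → ℝ) :
    k3Form (fun i => (a i : ℂ)) (fun i => (b i : ℂ)) = ((k3FormR a b : ℝ) : ℂ) := by
  rw [k3FormR_apply]
  simp only [k3Form, Complex.ofReal_sum, Complex.ofReal_mul, Complex.ofReal_intCast]

/-- The real K3 form on integral vectors is the integral lattice form. [folklore] -/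
theorem k3FormR_intCast (v w : K3Index → ℤ) :
    k3FormR (fun i => (v i : ℝ)) (fun i => (w i : ℝ)) = ((∑ i, ∑ j, v i * k3Gram i j * w j : ℤ) : ℝ) := by
  rw [k3FormR_apply]
  simp only [Int.cast_sum, Int.cast_mul]

/-! ### `E₈` is positive definite over `ℝ` -/

/-- The quadratic form of `E₈` in coordinates, over `ℝ` (Serre's basis of `Γ₈`).
[cite: Serre1973, Ch. V §1.4.3, p. 51] -/
theorem e8_quadratic (y : Fin 8 → ℝ) :
    ∑ i, ∑ j, y i * (CartanMatrix.E₈ i j : ℝ) * y j =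
      2 * (y 0 ^ 2 + y 1 ^ 2 + y 2 ^ 2 + y 3 ^ 2 + y 4 ^ 2 + y 5 ^ 2 + y 6 ^ 2 + y 7 ^ 2
        - y 0 * y 2 - y 1 * y 3 - y 2 * y 3 - y 3 * y 4 - y 4 * y 5 - y 5 * y 6 - y 6 * y 7) := by
  simp [CartanMatrix.E₈, Fin.sum_univ_succ, Matrix.of_apply]
  ring

/-- **`E₈` is positive definite over `ℝ`**: by Lagrange reduction along the Dynkin chain the
form is a positive combination of squares of a triangular system of linear forms.
[cite: Serre1973, Ch. V §1.4.3, pp. 50–51] -/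
theorem e8_quadratic_pos {y : Fin 8 → ℝ} (hy : y ≠ 0) :
    0 < ∑ i, ∑ j, y i * (CartanMatrix.E₈ i j : ℝ) * y j := by
  rw [e8_quadratic, ← not_le]
  intro h
  have aux : ∀ t : ℝ, t ^ 2 ≤ 0 → t = 0 := fun t ht =>
    pow_eq_zero_iff two_ne_zero |>.mp (le_antisymm ht (sq_nonneg t))
  have s7 := sq_nonneg (2 * y 7 - y 6)
  have s6 := sq_nonneg (3 * y 6 - 2 * y 5)
  have s5 := sq_nonneg (4 * y 5 - 3 * y 4)
  have s4 := sq_nonneg (5 * y 4 - 4 * y 3)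
  have s3 := sq_nonneg (6 * y 3 - 5 * (y 1 + y 2))
  have s1 := sq_nonneg (7 * y 1 - 5 * y 2)
  have s0 := sq_nonneg (2 * y 0 - y 2)
  have s2 := sq_nonneg (y 2)
  have h2 : y 2 = 0 := aux _ (by linarith)
  have h0 : 2 * y 0 - y 2 = 0 := aux _ (by linarith)
  have h1 : 7 * y 1 - 5 * y 2 = 0 := aux _ (by linarith)
  have h3 : 6 * y 3 - 5 * (y 1 + y 2) = 0 := aux _ (by linarith)
  have h4 : 5 * y 4 - 4 * y 3 = 0 := aux _ (by linarith)
  have h5 : 4 * y 5 - 3 * y 4 = 0 := aux _ (by linarith)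
  have h6 : 3 * y 6 - 2 * y 5 = 0 := aux _ (by linarith)
  have h7 : 2 * y 7 - y 6 = 0 := aux _ (by linarith)
  apply hy
  funext i
  fin_cases i <;> simp <;> linarith

/-- `E₈` is positive semi-definite over `ℝ`. [cite: Serre1973, Ch. V §1.4.3] -/
theorem e8_quadratic_nonneg (y : Fin 8 → ℝ) :
    0 ≤ ∑ i, ∑ j, y i * (CartanMatrix.E₈ i j : ℝ) * y j := by
  by_cases hy : y = 0
  · subst hy; simp
  · exact (e8_quadratic_pos hy).le

/-! ### The block expansion of the K3 form and an explicit negative definite `19`-space -/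

/-- The entries of the Gram matrix of the hyperbolic plane. [folklore] -/
theorem hyperbolicPlaneGram_apply :
    hyperbolicPlaneGram 0 0 = 0 ∧ hyperbolicPlaneGram 0 1 = 1 ∧ hyperbolicPlaneGram 1 0 = 1 ∧
      hyperbolicPlaneGram 1 1 = 0 := by
  refine ⟨rfl, rfl, rfl, rfl⟩

/-- **Block expansion of the K3 form** `Λ = E₈(−1) ⊕ E₈(−1) ⊕ U ⊕ U ⊕ U`:
`(t.t) = −E₈(t₁) − E₈(t₂) + 2 t_{a₀} t_{a₁} + 2 t_{b₀} t_{b₁} + 2 t_{c₀} t_{c₁}`.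
[cite: Huybrechts2016K3, Ch. 1 Prop. 3.5] -/
theorem k3FormR_self_eq (t : K3Index → ℝ) :
    k3FormR t t =
      -(∑ i, ∑ j, t (Sum.inl (Sum.inl i)) * (CartanMatrix.E₈ i j : ℝ) * t (Sum.inl (Sum.inl j)))
      - (∑ i, ∑ j, t (Sum.inl (Sum.inr i)) * (CartanMatrix.E₈ i j : ℝ) * t (Sum.inl (Sum.inr j)))
      + 2 * (t (Sum.inr (Sum.inl 0)) * t (Sum.inr (Sum.inl 1)))
      + 2 * (t (Sum.inr (Sum.inr (Sum.inl 0))) * t (Sum.inr (Sum.inr (Sum.inl 1))))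
      + 2 * (t (Sum.inr (Sum.inr (Sum.inr 0))) * t (Sum.inr (Sum.inr (Sum.inr 1)))) := by
  obtain ⟨h00, h01, h10, h11⟩ := hyperbolicPlaneGram_apply
  rw [k3FormR_apply]
  simp only [Fintype.sum_sum_type, k3Gram, Matrix.fromBlocks_apply₁₁, Matrix.fromBlocks_apply₁₂,
    Matrix.fromBlocks_apply₂₁, Matrix.fromBlocks_apply₂₂, Matrix.zero_apply, Matrix.neg_apply,
    Int.cast_zero, Int.cast_neg, mul_zero, zero_mul, Finset.sum_const_zero, add_zero, zero_add,
    Fin.sum_univ_two, h00, h01, h10, h11, Int.cast_one, mul_one, mul_neg, neg_mul,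
    Finset.sum_neg_distrib]
  ring

/-- The linear map `t ↦ (t_{a₀} + t_{a₁}, t_{b₀} + t_{b₁}, t_{c₀} + t_{c₁})` whose kernel is the
negative definite `19`-space `E₈(−1)^{⊕2}_ℝ ⊕ ⟨eₖ − fₖ⟩`. [cite: Huybrechts2016K3, Ch. 1 Prop. 3.5] -/
def negMap : (K3Index → ℝ) →ₗ[ℝ] (Fin 3 → ℝ) where
  toFun t := ![t (Sum.inr (Sum.inl 0)) + t (Sum.inr (Sum.inl 1)),
    t (Sum.inr (Sum.inr (Sum.inl 0))) + t (Sum.inr (Sum.inr (Sum.inl 1))),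
    t (Sum.inr (Sum.inr (Sum.inr 0))) + t (Sum.inr (Sum.inr (Sum.inr 1)))]
  map_add' s t := by
    funext k
    fin_cases k <;> simp <;> ring
  map_smul' c t := by
    funext k
    fin_cases k <;> simp <;> ring

/-- The three components of `negMap`. [folklore] -/
theorem negMap_apply (t : K3Index → ℝ) :
    negMap t 0 = t (Sum.inr (Sum.inl 0)) + t (Sum.inr (Sum.inl 1)) ∧
      negMap t 1 = t (Sum.inr (Sum.inr (Sum.inl 0))) + t (Sum.inr (Sum.inr (Sum.inl 1))) ∧
        negMap t 2 = t (Sum.inr (Sum.inr (Sum.inr 0))) + t (Sum.inr (Sum.inr (Sum.inr 1))) :=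
  ⟨rfl, rfl, rfl⟩

/-- Membership in the kernel of `negMap`: the three `U`-coordinates are anti-diagonal. [folklore] -/
theorem mem_ker_negMap {t : K3Index → ℝ} (ht : t ∈ LinearMap.ker negMap) :
    t (Sum.inr (Sum.inl 1)) = -t (Sum.inr (Sum.inl 0)) ∧
      t (Sum.inr (Sum.inr (Sum.inl 1))) = -t (Sum.inr (Sum.inr (Sum.inl 0))) ∧
        t (Sum.inr (Sum.inr (Sum.inr 1))) = -t (Sum.inr (Sum.inr (Sum.inr 0))) := by
  rw [LinearMap.mem_ker] at ht
  obtain ⟨e0, e1, e2⟩ := negMap_apply t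
  have h0 := congrFun ht 0
  have h1 := congrFun ht 1
  have h2 := congrFun ht 2
  rw [Pi.zero_apply] at h0 h1 h2
  rw [e0] at h0
  rw [e1] at h1
  rw [e2] at h2
  refine ⟨by linarith, by linarith, by linarith⟩

/-- **The kernel of `negMap` is negative semi-definite, and definite**: `(t.t) ≤ 0` with equality
only for `t = 0`. [cite: Huybrechts2016K3, Ch. 1 Prop. 3.5] -/
theorem k3FormR_self_of_mem_ker {t : K3Index → ℝ} (ht : t ∈ LinearMap.ker negMap) :
    k3FormR t t ≤ 0 ∧ (k3FormR t t = 0 → t = 0) := by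
  obtain ⟨h1, h2, h3⟩ := mem_ker_negMap ht
  have hE1 := e8_quadratic_nonneg fun i => t (Sum.inl (Sum.inl i))
  have hE2 := e8_quadratic_nonneg fun i => t (Sum.inl (Sum.inr i))
  have hs1 := sq_nonneg (t (Sum.inr (Sum.inl 0)))
  have hs2 := sq_nonneg (t (Sum.inr (Sum.inr (Sum.inl 0))))
  have hs3 := sq_nonneg (t (Sum.inr (Sum.inr (Sum.inr 0))))
  rw [k3FormR_self_eq, h1, h2, h3]
  refine ⟨by nlinarith, fun h0 => ?_⟩
  have hz1 : (fun i => t (Sum.inl (Sum.inl i))) = 0 := by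
    by_contra hne
    have := e8_quadratic_pos hne
    nlinarith
  have hz2 : (fun i => t (Sum.inl (Sum.inr i))) = 0 := by
    by_contra hne
    have := e8_quadratic_pos hne
    nlinarith
  have hE1' : ∑ i, ∑ j, t (Sum.inl (Sum.inl i)) * (CartanMatrix.E₈ i j : ℝ) * t (Sum.inl (Sum.inl j)) = 0 := by
    have := e8_quadratic_nonneg (0 : Fin 8 → ℝ)
    have h := congrFun hz1
    simp only [Pi.zero_apply] at h
    simp [h]
  have hE2' : ∑ i, ∑ j, t (Sum.inl (Sum.inr i)) * (CartanMatrix.E₈ i j : ℝ) * t (Sum.inl (Sum.inr j)) = 0 := by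
    have h := congrFun hz2
    simp only [Pi.zero_apply] at h
    simp [h]
  have ha : t (Sum.inr (Sum.inl 0)) = 0 := by nlinarith
  have hb : t (Sum.inr (Sum.inr (Sum.inl 0))) = 0 := by nlinarith
  have hc : t (Sum.inr (Sum.inr (Sum.inr 0))) = 0 := by nlinarith
  funext i
  rcases i with ((i | i) | (i | (i | i)))
  · exact congrFun hz1 i
  · exact congrFun hz2 i
  · fin_cases i
    · exact ha
    · simpa [ha] using h1
  · fin_cases i
    · exact hb
    · simpa [hb] using h2
  · fin_cases i
    · exact hc
    · simpa [hc] using h3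

/-- `rk Λ_ℝ = 22`. [cite: Huybrechts2016K3, Ch. 1 Prop. 3.5] -/
theorem finrank_k3Real : finrank ℝ (K3Index → ℝ) = 22 := by
  rw [finrank_fintype_fun_eq_card]
  rfl

/-- The negative space `ker negMap` has dimension at least `19` (rank–nullity). [folklore] -/
theorem le_finrank_ker_negMap : 19 ≤ finrank ℝ (LinearMap.ker negMap) := by
  have h := LinearMap.finrank_range_add_finrank_ker negMap
  have hr : finrank ℝ (LinearMap.range negMap) ≤ 3 := by
    have := Submodule.finrank_le (LinearMap.range negMap)
    rwa [finrank_fintype_fun_eq_card, Fintype.card_fin] at this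
  rw [finrank_k3Real] at h
  omega

/-! ### The signature argument -/

/-- **The real K3 form is negative definite on the orthogonal complement of three pairwise
orthogonal positive vectors** (signature `(3, 19)`; Sylvester's law of inertia by hand: a
positive semi-definite `4`-space would meet the negative definite `19`-space `ker negMap`
trivially, and `4 + 19 > 22`). [cite: Huybrechts2016K3, Ch. 1 Prop. 3.5] -/
theorem k3FormR_self_neg_of_orthogonal {p q r w : K3Index → ℝ}
    (hp : 0 < k3FormR p p) (hq : 0 < k3FormR q q) (hr : 0 < k3FormR r r)
    (hpq : k3FormR p q = 0) (hpr : k3FormR p r = 0) (hqr : k3FormR q r = 0)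
    (hwp : k3FormR w p = 0) (hwq : k3FormR w q = 0) (hwr : k3FormR w r = 0) (hw : w ≠ 0) :
    k3FormR w w < 0 := by
  by_contra hww
  rw [not_lt] at hww
  have hqp : k3FormR q p = 0 := by rw [k3FormR_comm, hpq]
  have hrp : k3FormR r p = 0 := by rw [k3FormR_comm, hpr]
  have hrq : k3FormR r q = 0 := by rw [k3FormR_comm, hqr]
  have hpw : k3FormR p w = 0 := by rw [k3FormR_comm, hwp]
  have hqw : k3FormR q w = 0 := by rw [k3FormR_comm, hwq]
  have hrw : k3FormR r w = 0 := by rw [k3FormR_comm, hwr]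
  let b : Fin 4 → (K3Index → ℝ) := ![p, q, r, w]
  have hb0 : b 0 = p := rfl
  have hb1 : b 1 = q := rfl
  have hb2 : b 2 = r := rfl
  have hb3 : b 3 = w := rfl
  -- the form is positive semi-definite on the span of `p, q, r, w`
  have hpos : ∀ t ∈ Submodule.span ℝ (Set.range b), 0 ≤ k3FormR t t := by
    intro t ht
    obtain ⟨g, rfl⟩ := (Submodule.mem_span_range_iff_exists_fun ℝ).1 ht
    simp only [Fin.sum_univ_four, hb0, hb1, hb2, hb3, map_add, map_smul, LinearMap.add_apply,
      LinearMap.smul_apply, smul_eq_mul, hpq, hpr, hqr, hqp, hrp, hrq, hwp, hwq, hwr, hpw, hqw, hrw,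
      mul_zero, add_zero, zero_add]
    have := sq_nonneg (g 0)
    have := sq_nonneg (g 1)
    have := sq_nonneg (g 2)
    have := sq_nonneg (g 3)
    nlinarith [mul_nonneg (sq_nonneg (g 0)) hp.le, mul_nonneg (sq_nonneg (g 1)) hq.le,
      mul_nonneg (sq_nonneg (g 2)) hr.le, mul_nonneg (sq_nonneg (g 3)) hww]
  -- `p, q, r, w` are linearly independent
  have hli : LinearIndependent ℝ b := by
    rw [Fintype.linearIndependent_iff]
    intro g hg
    have eP := congrArg (fun t => k3FormR t p) hg
    have eQ := congrArg (fun t => k3FormR t q) hg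
    have eR := congrArg (fun t => k3FormR t r) hg
    simp only [Fin.sum_univ_four, hb0, hb1, hb2, hb3, map_add, map_smul, LinearMap.add_apply,
      LinearMap.smul_apply, smul_eq_mul, hqp, hrp, hwp, hpq, hrq, hwq, hpr, hqr, hwr, mul_zero, add_zero,
      zero_add, map_zero, LinearMap.zero_apply] at eP eQ eR
    have g0 : g 0 = 0 := by
      rcases mul_eq_zero.1 eP with h | h
      · exact h
      · exact absurd h hp.ne'
    have g1 : g 1 = 0 := by
      rcases mul_eq_zero.1 eQ with h | h
      · exact h
      · exact absurd h hq.ne'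
    have g2 : g 2 = 0 := by
      rcases mul_eq_zero.1 eR with h | h
      · exact h
      · exact absurd h hr.ne'
    have g3 : g 3 = 0 := by
      simp only [Fin.sum_univ_four, hb0, hb1, hb2, hb3, g0, g1, g2, zero_smul, zero_add] at hg
      rcases smul_eq_zero.1 hg with h | h
      · exact h
      · exact absurd h hw
    intro i
    fin_cases i <;> assumption
  have hW : finrank ℝ (Submodule.span ℝ (Set.range b)) = 4 := by
    rw [finrank_span_eq_card hli, Fintype.card_fin]
  -- the span meets the negative space trivially
  have hinf : Submodule.span ℝ (Set.range b) ⊓ LinearMap.ker negMap = ⊥ := by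
    rw [eq_bot_iff]
    rintro t ⟨htW, htK⟩
    obtain ⟨hle, hdef⟩ := k3FormR_self_of_mem_ker htK
    rw [Submodule.mem_bot]
    exact hdef (le_antisymm hle (hpos t htW))
  -- dimension count
  have hdim := Submodule.finrank_sup_add_finrank_inf_eq (Submodule.span ℝ (Set.range b)) (LinearMap.ker negMap)
  rw [hinf, finrank_bot, add_zero, hW] at hdim
  have hle : finrank ℝ ↥(Submodule.span ℝ (Set.range b) ⊔ LinearMap.ker negMap) ≤ 22 :=
    (Submodule.finrank_le _).trans_eq finrank_k3Real
  have hK := le_finrank_ker_negMap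
  omega

end Summit.HodgeConjecture.HodgeConjecture.Theorems.AnchorExistenceCMFloor

end
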